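import Literature.NumberTheory.LFunctions.BondarenkoHeap2026PrimeSumsProofs
import Mathlib.Analysis.MellinInversion
import HarnessLib

/-!
# Mellin inversion and its truncation for smooth weights supported in `[1, 2]`

Generic toolkit (layer L1 of the §6.2 "separation of variables by an inverse Mellin transform
truncated at height `q^ε`" of Bondarenko–Heap, arXiv:2608.07399v1, TeX l.800–832; see
`ah/MEMO-t3-offDiagReduction.md`): for `V : ℝ → ℂ` smooth with `V(x) ≠ 0 ⇒ 1 ≤ x ≤ 2`,

* `mellinConvergent_of_support` — `𝓜V(s)` converges for every `s` (complex-valued variant, in the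
  support convention of `BondarenkoHeap2026PrimeSumsProofs`, of the tree's
  `mellinConvergent_ofReal_of_continuousOn` in `MellinVanishingIntegral.lean`);
* `continuous_mellin_vertical`, `norm_mellin_vertical_le`, `verticalIntegrable_mellin` — on a line
  `Re s = σ > 0`, `t ↦ 𝓜V(σ+it)` is continuous and `‖𝓜V(σ+it)‖ ≤ M₂ 2^{σ+1}/(σ² + t²)`
  (`M₂ = sup ‖V''‖`, two integrations by parts from the sibling toolkit
  `BondarenkoHeap2026.PrimeSums.norm_mellin_le_of_iteratedDeriv`), hence vertically integrable;
* `eq_mellinInv` — **Mellin inversion** `V(x) = (1/2π) ∫ x^{−(σ+it)} 𝓜V(σ+it) dt` (`x > 0`,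
  `σ > 0`), from Mathlib's `mellinInv_mellin_eq`;
* `norm_mellin_vertical_le_pow` — the decay `‖𝓜V(σ+it)‖ ≤ M_j 2^{σ+j−1}/|t|^j` (`j` integrations
  by parts), and
* `norm_sub_truncated_mellinInv_le` — **truncated Mellin inversion**: for `σ > 0`, `H ≥ 1`, `j ≥ 2`,
  `‖V(x) − (1/2π)∫_{−H}^{H} x^{−(σ+it)} 𝓜V(σ+it) dt‖ ≤ x^{−σ} M_j 2^{σ+j−1}/H^{j−2}` — the
  "truncate the `s_j` integrals at height `q^ε` … negligible error by the rapid decay" step, with an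
  explicit constant (tail bounded through `|t|^{−j} ≤ 2H^{2−j}/(1+t²)` and `∫(1+t²)⁻¹ = π`).

RH-free real/complex analysis; nothing here bears on the truth of RH.

## References

* [BondarenkoHeap2026] arXiv:2608.07399v1, §6.2, TeX l.800–832 (inverse Mellin transform, decay by
  integration by parts, truncation at height `q^ε`).
* [Titchmarsh1948] E. C. Titchmarsh, *Introduction to the theory of Fourier integrals*, §1.29
  (Mellin inversion).
-/

noncomputable section

open Real Complex MeasureTheory Set Filter
open scoped ContDiff

namespace Literature.NumberTheory.LFunctions.MellinTruncated

open Literature.NumberTheory.LFunctions.BondarenkoHeap2026.PrimeSums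
  (mellin_eq_intervalIntegral norm_mellin_le_of_iteratedDeriv)

variable {V : ℝ → ℂ}

/-- A weight supported in `[1,2]` has a Mellin transform converging at every `s`.
[cite: Titchmarsh1948, §1.29] -/
theorem mellinConvergent_of_support (hc : Continuous V) (hsupp : ∀ x : ℝ, V x ≠ 0 → 1 ≤ x ∧ x ≤ 2)
    (s : ℂ) : MellinConvergent V s := by
  have h1 : IntegrableOn (fun t : ℝ => (t : ℂ) ^ (s - 1) • V t) (Icc 1 2) := by
    refine ContinuousOn.integrableOn_compact isCompact_Icc ?_
    intro t ht
    have ht0 : 0 < t := by linarith [ht.1]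
    exact ((Complex.continuousAt_ofReal_cpow_const t (s - 1) (Or.inr ht0.ne')).smul
      hc.continuousAt).continuousWithinAt
  refine h1.of_forall_sdiff_eq_zero measurableSet_Ioi ?_
  intro t ht
  have hV : V t = 0 := by
    by_contra h
    exact ht.2 ⟨(hsupp t h).1, (hsupp t h).2⟩
  simp [hV]

/-- `t ↦ 𝓜V(σ + it)` is continuous (parametric integral over `[1,2]`). [cite: Titchmarsh1948, §1.29] -/
theorem continuous_mellin_vertical (hc : Continuous V) (hsupp : ∀ x : ℝ, V x ≠ 0 → 1 ≤ x ∧ x ≤ 2)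
    (σ : ℝ) : Continuous fun t : ℝ => mellin V ((σ : ℂ) + t * I) := by
  have heq : (fun t : ℝ => mellin V ((σ : ℂ) + t * I)) =
      fun t : ℝ => ∫ x in (1 : ℝ)..2, ((max x 1 : ℝ) : ℂ) ^ ((σ : ℂ) + (t : ℂ) * I - 1) * V x := by
    funext t
    rw [mellin_eq_intervalIntegral hc hsupp]
    refine intervalIntegral.integral_congr fun x hx => ?_
    rw [uIcc_of_le (by norm_num : (1 : ℝ) ≤ 2)] at hx
    rw [max_eq_left hx.1]
  rw [heq]
  refine intervalIntegral.continuous_parametric_intervalIntegral_of_continuous (a₀ := 1) ?_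
    continuous_const
  refine Continuous.mul ?_ (hc.comp continuous_snd)
  refine Continuous.cpow ?_ (by fun_prop) ?_
  · exact Complex.continuous_ofReal.comp ((continuous_snd.max continuous_const))
  · intro p
    exact Complex.ofReal_mem_slitPlane.2 (lt_of_lt_of_le zero_lt_one (le_max_right _ _))

/-- **Decay on a vertical line from two integrations by parts**: for `σ > 0` and
`‖V''‖ ≤ M₂`, `‖𝓜V(σ+it)‖ ≤ M₂ 2^{σ+1}/(σ² + t²)`. [cite: BondarenkoHeap2026, §6.2, TeX l.826–828 ("integration by parts shows …")] -/
theorem norm_mellin_vertical_le (hV : ContDiff ℝ ∞ V) (hsupp : ∀ x : ℝ, V x ≠ 0 → 1 ≤ x ∧ x ≤ 2)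
    {M₂ : ℝ} (hM : ∀ x, ‖iteratedDeriv 2 V x‖ ≤ M₂) {σ : ℝ} (hσ : 0 < σ) (t : ℝ) :
    ‖mellin V ((σ : ℂ) + t * I)‖ ≤ M₂ * (2 : ℝ) ^ (σ + 1) / (σ ^ 2 + t ^ 2) := by
  set w : ℂ := (σ : ℂ) + t * I with hw
  have hM0 : 0 ≤ M₂ := (norm_nonneg _).trans (hM 0)
  have hwi : ∀ i : ℕ, i < 2 → w + i ≠ 0 := by
    intro i _ h
    have := congrArg Complex.re h
    simp [hw] at this
    linarith [(Nat.cast_nonneg i : (0 : ℝ) ≤ i)]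
  have h := norm_mellin_le_of_iteratedDeriv hV hsupp 2 hM hwi
  have hre : w.re = σ := by simp [hw]
  have hmax : max (w.re + (2 : ℕ) - 1) 0 = σ + 1 := by
    rw [hre, max_eq_left (by push_cast; linarith)]; push_cast; ring
  rw [hmax] at h
  -- `∏_{i<2} ‖w + i‖ = ‖w‖ ‖w+1‖ ≥ σ² + t²`
  have hprod : ∏ i ∈ Finset.range 2, ‖w + (i : ℂ)‖ = ‖w‖ * ‖w + 1‖ := by
    simp [Finset.prod_range_succ]
  rw [hprod] at h
  have hn0 : ‖w‖ ^ 2 = σ ^ 2 + t ^ 2 := by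
    rw [Complex.sq_norm, Complex.normSq_apply]; simp [hw]; ring
  have hn1 : ‖w + 1‖ ^ 2 = (σ + 1) ^ 2 + t ^ 2 := by
    rw [Complex.sq_norm, Complex.normSq_apply]; simp [hw]; ring
  have hle : σ ^ 2 + t ^ 2 ≤ ‖w‖ * ‖w + 1‖ := by
    have h1 : ‖w‖ ≤ ‖w + 1‖ := by
      have := norm_nonneg (w + 1)
      nlinarith [hn0, hn1, norm_nonneg w]
    calc σ ^ 2 + t ^ 2 = ‖w‖ * ‖w‖ := by rw [← sq, hn0]
      _ ≤ ‖w‖ * ‖w + 1‖ := mul_le_mul_of_nonneg_left h1 (norm_nonneg _)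
  have hpos : 0 < σ ^ 2 + t ^ 2 := by positivity
  calc ‖mellin V w‖ ≤ M₂ * 2 ^ (σ + 1) / (‖w‖ * ‖w + 1‖) := h
    _ ≤ M₂ * 2 ^ (σ + 1) / (σ ^ 2 + t ^ 2) :=
        div_le_div_of_nonneg_left (by positivity) hpos hle

/-- `𝓜V` is vertically integrable on `Re s = σ > 0`. [cite: Titchmarsh1948, §1.29] -/
theorem verticalIntegrable_mellin (hV : ContDiff ℝ ∞ V) (hsupp : ∀ x : ℝ, V x ≠ 0 → 1 ≤ x ∧ x ≤ 2)
    {M₂ : ℝ} (hM : ∀ x, ‖iteratedDeriv 2 V x‖ ≤ M₂) {σ : ℝ} (hσ : 0 < σ) :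
    VerticalIntegrable (mellin V) σ := by
  rw [Complex.VerticalIntegrable]
  have hM0 : 0 ≤ M₂ := (norm_nonneg _).trans (hM 0)
  set c : ℝ := max 1 (1 / σ ^ 2) with hc
  have hc1 : 1 ≤ c := le_max_left _ _
  -- `1/(σ² + t²) ≤ c/(1 + t²)`
  have hcomp : ∀ t : ℝ, M₂ * (2 : ℝ) ^ (σ + 1) / (σ ^ 2 + t ^ 2) ≤
      M₂ * (2 : ℝ) ^ (σ + 1) * c * (1 + t ^ 2)⁻¹ := by
    intro t
    have h2 : 1 / σ ^ 2 ≤ c := le_max_right _ _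
    have h3 : 1 ≤ c * σ ^ 2 := by
      rw [div_le_iff₀ (by positivity)] at h2; linarith
    have hkey : 1 / (σ ^ 2 + t ^ 2) ≤ c / (1 + t ^ 2) := by
      rw [div_le_div_iff₀ (by positivity) (by positivity), one_mul]
      nlinarith [sq_nonneg t]
    calc M₂ * (2 : ℝ) ^ (σ + 1) / (σ ^ 2 + t ^ 2) = M₂ * (2 : ℝ) ^ (σ + 1) * (1 / (σ ^ 2 + t ^ 2)) := by
          ring
      _ ≤ M₂ * (2 : ℝ) ^ (σ + 1) * (c / (1 + t ^ 2)) := mul_le_mul_of_nonneg_left hkey (by positivity)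
      _ = M₂ * (2 : ℝ) ^ (σ + 1) * c * (1 + t ^ 2)⁻¹ := by ring
  refine Integrable.mono' (g := fun t : ℝ => M₂ * (2 : ℝ) ^ (σ + 1) * c * (1 + t ^ 2)⁻¹)
    ((integrable_inv_one_add_sq).const_mul _)
    (continuous_mellin_vertical hV.continuous hsupp σ).aestronglyMeasurable
    (Eventually.of_forall fun t => (norm_mellin_vertical_le hV hsupp hM hσ t).trans (hcomp t))

/-- **Mellin inversion** for a smooth weight supported in `[1,2]`: for `x > 0` and `σ > 0`,
`V(x) = (1/2π) ∫ x^{−(σ+it)} 𝓜V(σ+it) dt`. [cite: Titchmarsh1948, §1.29] -/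
theorem eq_mellinInv (hV : ContDiff ℝ ∞ V) (hsupp : ∀ x : ℝ, V x ≠ 0 → 1 ≤ x ∧ x ≤ 2)
    {M₂ : ℝ} (hM : ∀ x, ‖iteratedDeriv 2 V x‖ ≤ M₂) {σ : ℝ} (hσ : 0 < σ) {x : ℝ} (hx : 0 < x) :
    V x = (1 / (2 * π)) • ∫ t : ℝ, (x : ℂ) ^ (-((σ : ℂ) + t * I)) • mellin V ((σ : ℂ) + t * I) := by
  have h := mellinInv_mellin_eq σ V hx (mellinConvergent_of_support hV.continuous hsupp _)
    (verticalIntegrable_mellin hV hsupp hM hσ) hV.continuous.continuousAt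
  rw [← h, mellinInv]

/-- **Decay of order `j`** on the line `Re s = σ > 0`: with `‖V^{(j)}‖ ≤ M_j`,
`‖𝓜V(σ+it)‖ ≤ M_j 2^{σ+j−1}/|t|^j` (`t ≠ 0`). [cite: BondarenkoHeap2026, §6.2, TeX l.826–828] -/
theorem norm_mellin_vertical_le_pow (hV : ContDiff ℝ ∞ V)
    (hsupp : ∀ x : ℝ, V x ≠ 0 → 1 ≤ x ∧ x ≤ 2) {j : ℕ} (hj : 1 ≤ j) {Mj : ℝ}
    (hM : ∀ x, ‖iteratedDeriv j V x‖ ≤ Mj) {σ : ℝ} (hσ : 0 < σ) {t : ℝ} (ht : t ≠ 0) :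
    ‖mellin V ((σ : ℂ) + t * I)‖ ≤ Mj * (2 : ℝ) ^ (σ + j - 1) / |t| ^ j := by
  set w : ℂ := (σ : ℂ) + t * I with hw
  have hM0 : 0 ≤ Mj := (norm_nonneg _).trans (hM 0)
  have hwi : ∀ i : ℕ, i < j → w + i ≠ 0 := by
    intro i _ h
    have := congrArg Complex.re h
    simp [hw] at this
    linarith [(Nat.cast_nonneg i : (0 : ℝ) ≤ i)]
  have h := norm_mellin_le_of_iteratedDeriv hV hsupp j hM hwi
  have hre : w.re = σ := by simp [hw]
  have hj1 : (1 : ℝ) ≤ j := by exact_mod_cast hj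
  have hmax : max (w.re + (j : ℕ) - 1) 0 = σ + j - 1 := by
    rw [hre, max_eq_left (by linarith)]
  rw [hmax] at h
  -- each factor `‖w + i‖ ≥ |t|`
  have hfac : ∀ i : ℕ, |t| ≤ ‖w + (i : ℂ)‖ := by
    intro i
    have him : (w + (i : ℂ)).im = t := by simp [hw]
    calc |t| = |(w + (i : ℂ)).im| := by rw [him]
      _ ≤ ‖w + (i : ℂ)‖ := Complex.abs_im_le_norm _
  have htpos : 0 < |t| := abs_pos.mpr ht
  have hprod : |t| ^ j ≤ ∏ i ∈ Finset.range j, ‖w + (i : ℂ)‖ := by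
    calc |t| ^ j = ∏ _i ∈ Finset.range j, |t| := by simp
      _ ≤ ∏ i ∈ Finset.range j, ‖w + (i : ℂ)‖ :=
          Finset.prod_le_prod (fun _ _ => htpos.le) fun i _ => hfac i
  calc ‖mellin V w‖ ≤ Mj * 2 ^ (σ + j - 1) / ∏ i ∈ Finset.range j, ‖w + (i : ℂ)‖ := h
    _ ≤ Mj * 2 ^ (σ + j - 1) / |t| ^ j :=
        div_le_div_of_nonneg_left (by positivity) (by positivity) hprod


/-- **Truncated Mellin inversion** ("We then truncate the `s_j` integrals at height `q^ε`. This gives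
a negligible error … by the rapid decay", TeX l.829–830): for `σ > 0`, `H ≥ 1`, `j ≥ 2`, `x > 0`,
`‖V(x) − (1/2π)∫_{−H}^{H} x^{−(σ+it)} 𝓜V(σ+it) dt‖ ≤ x^{−σ} M_j 2^{σ+j−1}/H^{j−2}`
(`M_j = sup ‖V^{(j)}‖`, `M₂ = sup ‖V''‖` only enters the convergence).
[cite: BondarenkoHeap2026, §6.2, TeX l.826–832] -/
theorem norm_sub_truncated_mellinInv_le (hV : ContDiff ℝ ∞ V)
    (hsupp : ∀ x : ℝ, V x ≠ 0 → 1 ≤ x ∧ x ≤ 2) {M₂ : ℝ} (hM₂ : ∀ x, ‖iteratedDeriv 2 V x‖ ≤ M₂)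
    {j : ℕ} (hj : 2 ≤ j) {Mj : ℝ} (hMj : ∀ x, ‖iteratedDeriv j V x‖ ≤ Mj) {σ : ℝ} (hσ : 0 < σ)
    {H : ℝ} (hH : 1 ≤ H) {x : ℝ} (hx : 0 < x) :
    ‖V x - (1 / (2 * π)) • ∫ t in -H..H, (x : ℂ) ^ (-((σ : ℂ) + t * I)) • mellin V ((σ : ℂ) + t * I)‖
      ≤ x ^ (-σ) * Mj * (2 : ℝ) ^ (σ + j - 1) / H ^ (j - 2) := by
  set F : ℝ → ℂ := fun t => (x : ℂ) ^ (-((σ : ℂ) + t * I)) • mellin V ((σ : ℂ) + t * I) with hF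
  have hMj0 : 0 ≤ Mj := (norm_nonneg _).trans (hMj 0)
  have hH0 : 0 < H := by linarith
  have hxσ : 0 < x ^ (-σ) := Real.rpow_pos_of_pos hx _
  -- `‖x^{-(σ+it)}‖ = x^{-σ}`
  have hxpow : ∀ t : ℝ, ‖(x : ℂ) ^ (-((σ : ℂ) + t * I))‖ = x ^ (-σ) := by
    intro t
    rw [Complex.norm_cpow_eq_rpow_re_of_pos hx]
    congr 1
    simp
  have hcpow : Continuous fun t : ℝ => (x : ℂ) ^ (-((σ : ℂ) + t * I)) := by
    refine Continuous.const_cpow (by fun_prop) (Or.inl ?_)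
    exact_mod_cast hx.ne'
  -- `F` is integrable
  have hvi := verticalIntegrable_mellin hV hsupp hM₂ hσ
  rw [Complex.VerticalIntegrable] at hvi
  have hFi : Integrable F := by
    refine (hvi.norm.const_mul (x ^ (-σ))).mono'
      ((hcpow.smul (continuous_mellin_vertical hV.continuous hsupp σ)).aestronglyMeasurable)
      (Eventually.of_forall fun t => ?_)
    simp only [hF, norm_smul, hxpow]
    exact le_rfl
  -- Mellin inversion and the split `ℝ = (−H, H] ∪ (−H, H]ᶜ`
  have hV' : V x = (1 / (2 * π)) • ∫ t, F t := eq_mellinInv hV hsupp hM₂ hσ hx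
  have hsplit := integral_add_compl (s := Ioc (-H) H) measurableSet_Ioc hFi
  have hIoc : ∫ t in Ioc (-H) H, F t = ∫ t in -H..H, F t :=
    (intervalIntegral.integral_of_le (by linarith)).symm
  have hdiff : V x - (1 / (2 * π)) • ∫ t in -H..H, F t =
      (1 / (2 * π)) • ∫ t in (Ioc (-H) H)ᶜ, F t := by
    rw [hV', ← hsplit, hIoc, smul_add, add_sub_cancel_left]
  change ‖V x - (1 / (2 * π)) • ∫ t in -H..H, F t‖ ≤ _
  rw [hdiff, norm_smul, Real.norm_eq_abs, abs_of_pos (by positivity)]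
  -- pointwise bound on the complement: `|t| ≥ H ≥ 1`
  set g : ℝ → ℝ := fun t => x ^ (-σ) * Mj * (2 : ℝ) ^ (σ + j - 1) / H ^ (j - 2) * (2 * (1 + t ^ 2)⁻¹)
    with hg
  have hgi : Integrable g := (integrable_inv_one_add_sq.const_mul 2).const_mul _
  have hg0 : ∀ t, 0 ≤ g t := fun t => by simp only [hg]; positivity
  have hptw : ∀ t ∈ (Ioc (-H) H)ᶜ, ‖F t‖ ≤ g t := by
    intro t ht
    simp only [mem_compl_iff, mem_Ioc, not_and_or, not_lt, not_le] at ht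
    have htH : H ≤ |t| := by
      rcases ht with h | h
      · rw [abs_of_nonpos (by linarith)]; linarith
      · rw [abs_of_pos (by linarith)]; linarith
    have ht1 : 1 ≤ |t| := le_trans hH htH
    have ht0 : t ≠ 0 := by intro h0; rw [h0, abs_zero] at ht1; linarith
    have hdec := norm_mellin_vertical_le_pow hV hsupp (by omega : 1 ≤ j) hMj hσ ht0
    -- `1/|t|^j ≤ (1/H^{j-2}) · 2/(1+t²)`
    have hpow : |t| ^ j = |t| ^ (j - 2) * t ^ 2 := by
      rw [← sq_abs t, ← pow_add, Nat.sub_add_cancel hj]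
    have hHj : H ^ (j - 2) ≤ |t| ^ (j - 2) := pow_le_pow_left₀ hH0.le htH _
    have ht2 : 1 ≤ t ^ 2 := by rw [← sq_abs]; nlinarith
    have hkey : 1 / |t| ^ j ≤ 1 / H ^ (j - 2) * (2 * (1 + t ^ 2)⁻¹) := by
      rw [hpow]
      have hHp : 0 < H ^ (j - 2) := pow_pos hH0 _
      have h1 : 1 / (|t| ^ (j - 2) * t ^ 2) ≤ 1 / (H ^ (j - 2) * t ^ 2) :=
        div_le_div_of_nonneg_left zero_le_one (by positivity)
          (mul_le_mul_of_nonneg_right hHj (by positivity))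
      have h2 : 1 / (H ^ (j - 2) * t ^ 2) ≤ 1 / H ^ (j - 2) * (2 * (1 + t ^ 2)⁻¹) := by
        rw [one_div_mul_eq_div, div_le_div_iff₀ (by positivity) hHp]
        rw [show 2 * (1 + t ^ 2)⁻¹ * (H ^ (j - 2) * t ^ 2) = H ^ (j - 2) * (2 * t ^ 2 / (1 + t ^ 2)) by
          field_simp]
        have : (1 : ℝ) ≤ 2 * t ^ 2 / (1 + t ^ 2) := by
          rw [le_div_iff₀ (by positivity)]; linarith
        nlinarith
      exact h1.trans h2
    calc ‖F t‖ = x ^ (-σ) * ‖mellin V ((σ : ℂ) + t * I)‖ := by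
          simp only [hF, norm_smul, hxpow]
      _ ≤ x ^ (-σ) * (Mj * (2 : ℝ) ^ (σ + j - 1) / |t| ^ j) :=
          mul_le_mul_of_nonneg_left hdec hxσ.le
      _ = x ^ (-σ) * Mj * (2 : ℝ) ^ (σ + j - 1) * (1 / |t| ^ j) := by ring
      _ ≤ x ^ (-σ) * Mj * (2 : ℝ) ^ (σ + j - 1) * (1 / H ^ (j - 2) * (2 * (1 + t ^ 2)⁻¹)) :=
          mul_le_mul_of_nonneg_left hkey (by positivity)
      _ = g t := by simp only [hg]; ring
  -- integrate
  have htail : ‖∫ t in (Ioc (-H) H)ᶜ, F t‖ ≤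
      x ^ (-σ) * Mj * (2 : ℝ) ^ (σ + j - 1) / H ^ (j - 2) * (2 * π) := by
    calc ‖∫ t in (Ioc (-H) H)ᶜ, F t‖ ≤ ∫ t in (Ioc (-H) H)ᶜ, ‖F t‖ :=
          norm_integral_le_integral_norm _
      _ ≤ ∫ t in (Ioc (-H) H)ᶜ, g t :=
          setIntegral_mono_on hFi.norm.integrableOn hgi.integrableOn
            (measurableSet_Ioc.compl) hptw
      _ ≤ ∫ t, g t := setIntegral_le_integral hgi (Eventually.of_forall hg0)
      _ = x ^ (-σ) * Mj * (2 : ℝ) ^ (σ + j - 1) / H ^ (j - 2) * (2 * π) := by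
          simp only [hg]
          rw [integral_const_mul, integral_const_mul, integral_univ_inv_one_add_sq]
  calc 1 / (2 * π) * ‖∫ t in (Ioc (-H) H)ᶜ, F t‖
      ≤ 1 / (2 * π) * (x ^ (-σ) * Mj * (2 : ℝ) ^ (σ + j - 1) / H ^ (j - 2) * (2 * π)) :=
        mul_le_mul_of_nonneg_left htail (by positivity)
    _ = x ^ (-σ) * Mj * (2 : ℝ) ^ (σ + j - 1) / H ^ (j - 2) := by
        field_simp

end Literature.NumberTheory.LFunctions.MellinTruncated
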